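import Summits.HubbardSuperconductivity.HubbardSuperconductivity.Theses.WeakCouplingBCS
import Literature.MathematicalPhysics.QuantumLattice.TorusPairSusceptibility
import HarnessLib

/-!
# Strategy census r1 — typed companion for crux `WcbcsSsbToTorusLRO` (stmt-HubbardSuperconductivity-2009)

Redirect strategist r1 (unit `cstrat-stmt-HubbardSuperconductivity-2009-r1`, 2026-08-17). Kernel-checked
PLACING THEOREMS for the tribunal (option (3) of the r1 instruction: "confirm no-strategy with the theorem
that makes the crux summit-strength"). Everything here is proved; no `sorry`, no new named fact.

§A  The crux is the summit MATRIX asserted on the whole ordered weak-coupling window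
    (`crux_iff_matrixOnOrderedWindow`).
§B  DICHOTOMY (`crux_dichotomy`): with `Q := WeakCouplingOrder` ("density-matched Koma–Tasaki d-wave order
    exists somewhere in every weak-coupling window" — a statement about the SOURCED grand-canonical
    functional only, with no long-range-order content), EITHER `¬Q` and the crux holds VACUOUSLY, OR `Q` and
    the crux ALONE implies the summit `HubbardSuperconductivity`. `Q` is implied by the route's other crux
    (`weakCouplingOrder_of_bcsConstruction`) and by the NEGATION of this crux
    (`weakCouplingOrder_of_not_crux`), so in every world in which the route is alive, or in which a refuter
    could succeed, the crux is at least the summit (`summitStrength`).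
§C  The only strengthening of child C (charging floor) with structure — grand-canonical EXPOSURE of the
    pinned filling — is exactly midpoint convexity of the sector energy (`pairGap_nonneg_of_locallyExposed`,
    `locallyExposed_of_pairGap_nonneg`): a restatement, recorded so that it is not filed as a stub.
§D  Certificate-by-dual-witness form of the conclusion (`floor_of_penalty`): an every-ground-state floor
    follows from — and in finite dimension is equivalent to — an operator PENALTY inequality
    `A + λ (H − E₀) ≥ t` on the sector; the census explains why `λ` is forced to the `O(L⁴)`/`O(1)` scale.
-/

noncomputable section

set_option linter.dupNamespace false

namespace Summit.HubbardSuperconductivity.HubbardSuperconductivity.Cruxes.WcbcsSsbToTorusLRO.StrategistR1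

open Literature.MathematicalPhysics.QuantumLattice Literature.Barriers.HubbardSuperconductivity
open Filter Set Matrix
open scoped ComplexOrder
open Summit.HubbardSuperconductivity.HubbardSuperconductivity.Theses.WeakCouplingBCS
  (WcbcsSsbToTorusLRO WcbcsBcsConstruction WcbcsThesis)

/-! ## §A Normal form: the crux is the summit matrix on the ordered weak-coupling window -/

/-- Density matching at `(U, δ, μ)` — verbatim the crux's first hypothesis. -/
def DensityMatched (U δ μ : ℝ) : Prop :=
  Tendsto (fun L : ℕ => ((hubbardTorusWith 2 (L + 1) 1 U μ).groundStateFunctional totalNumber).re /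
    ((L + 1 : ℕ) : ℝ) ^ 2) atTop (nhds (1 - δ))

/-- `(U, δ)` is an ORDERED point: some density-matched `μ` carries Koma–Tasaki `d`-wave order. -/
def OrderedAt (U δ : ℝ) : Prop := ∃ μ : ℝ, DensityMatched U δ μ ∧ HasDWaveOrder U μ

/-- `Q`: weak-coupling `d`-wave order exists somewhere in EVERY window `(0, U₀)` at some doping `δ < 1/2`.
No long-range-order content: it speaks of the sourced grand-canonical ground-state functional only. -/
def WeakCouplingOrder : Prop :=
  ∀ U₀ : ℝ, 0 < U₀ → ∃ U ∈ Ioo (0:ℝ) U₀, ∃ δ ∈ Ioo (0:ℝ) (1 / 2), OrderedAt U δ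

/-- The crux, read literally: the summit's matrix `HasDWavePairFieldLROAt U δ` at EVERY ordered point of a
weak-coupling window. -/
theorem crux_iff_matrixOnOrderedWindow :
    WcbcsSsbToTorusLRO ↔ ∃ U₀ : ℝ, 0 < U₀ ∧ ∀ U ∈ Ioo (0:ℝ) U₀, ∀ δ ∈ Ioo (0:ℝ) (1 / 2),
      OrderedAt U δ → HasDWavePairFieldLROAt U δ := by
  unfold WcbcsSsbToTorusLRO OrderedAt DensityMatched
  constructor
  · rintro ⟨U₀, hU₀, h⟩
    exact ⟨U₀, hU₀, fun U hU δ hδ ⟨μ, hd, ho⟩ => h U hU δ hδ μ hd ho⟩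
  · rintro ⟨U₀, hU₀, h⟩
    exact ⟨U₀, hU₀, fun U hU δ hδ μ hd ho => h U hU δ hδ ⟨μ, hd, ho⟩⟩

/-- The summit, read literally: the matrix at ONE point. -/
theorem summit_iff_matrixAtOnePoint :
    _root_.HubbardSuperconductivity ↔ ∃ U : ℝ, 0 < U ∧ ∃ δ ∈ Ioo (0:ℝ) (1 / 2), HasDWavePairFieldLROAt U δ :=
  Iff.rfl

/-! ## §B The dichotomy: vacuous, or at least the summit -/

/-- VACUOUS CASE. If weak-coupling order fails in some window, the crux holds with that window, vacuously. -/
theorem crux_of_not_weakCouplingOrder (h : ¬ WeakCouplingOrder) : WcbcsSsbToTorusLRO := by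
  unfold WeakCouplingOrder at h
  push Not at h
  obtain ⟨U₀, hU₀, hno⟩ := h
  rw [crux_iff_matrixOnOrderedWindow]
  exact ⟨U₀, hU₀, fun U hU δ hδ hord => (hno U hU δ hδ hord).elim⟩

/-- CONTENT CASE. If weak-coupling order exists in every window, the crux ALONE gives the summit. -/
theorem summit_of_crux_of_weakCouplingOrder (hc : WcbcsSsbToTorusLRO) (hQ : WeakCouplingOrder) :
    _root_.HubbardSuperconductivity := by
  rw [crux_iff_matrixOnOrderedWindow] at hc
  obtain ⟨U₀, hU₀, h⟩ := hc
  obtain ⟨U, hU, δ, hδ, hord⟩ := hQ U₀ hU₀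
  exact ⟨U, hU.1, δ, hδ, h U hU δ hδ hord⟩

/-- **Dichotomy.** The crux is either vacuous or at least the summit. -/
theorem crux_dichotomy :
    (¬ WeakCouplingOrder ∧ WcbcsSsbToTorusLRO) ∨
      (WeakCouplingOrder ∧ (WcbcsSsbToTorusLRO → _root_.HubbardSuperconductivity)) := by
  by_cases hQ : WeakCouplingOrder
  · exact Or.inr ⟨hQ, fun hc => summit_of_crux_of_weakCouplingOrder hc hQ⟩
  · exact Or.inl ⟨hQ, crux_of_not_weakCouplingOrder hQ⟩

/-- Summit strength relative to `Q` (the T1 reading): under `Q`, `crux → S`. -/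
theorem summitStrength (hQ : WeakCouplingOrder) : WcbcsSsbToTorusLRO → _root_.HubbardSuperconductivity :=
  fun hc => summit_of_crux_of_weakCouplingOrder hc hQ

/-- Any REFUTATION of the crux first proves weak-coupling `d`-wave order (cf. Disproof §2
`not_crux_imp_order_io`): `Q` holds in every world where a disprover can succeed. -/
theorem weakCouplingOrder_of_not_crux (h : ¬ WcbcsSsbToTorusLRO) : WeakCouplingOrder := by
  by_contra hQ
  exact h (crux_of_not_weakCouplingOrder hQ)

/-- `Q` is implied by the route's other crux `WcbcsBcsConstruction` (rate and fixed doping dropped):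
`Q` holds in every world where the route is alive. -/
theorem weakCouplingOrder_of_bcsConstruction (h : WcbcsBcsConstruction) : WeakCouplingOrder := by
  obtain ⟨δ, hδ, U₀, hU₀, C, _hC, h4⟩ := h
  intro U₁ hU₁
  have hpos : (0 : ℝ) < min U₀ U₁ / 2 := half_pos (lt_min hU₀ hU₁)
  have hlt : min U₀ U₁ / 2 < min U₀ U₁ := half_lt_self (lt_min hU₀ hU₁)
  obtain ⟨μ, hdens, hm⟩ := h4 (min U₀ U₁ / 2) ⟨hpos, lt_of_lt_of_le hlt (min_le_left U₀ U₁)⟩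
  refine ⟨min U₀ U₁ / 2, ⟨hpos, lt_of_lt_of_le hlt (min_le_right U₀ U₁)⟩, δ, hδ, μ, hdens, ?_⟩
  exact (hasDWaveOrder_iff _ _).2 (lt_of_lt_of_le (Real.exp_pos _) hm)

/-- Hence the crux and `¬Q` cannot both fail, and `Q` decides which face the crux shows:
`crux ↔ (Q → crux)`. -/
theorem crux_iff_of_weakCouplingOrder_imp : WcbcsSsbToTorusLRO ↔ (WeakCouplingOrder → WcbcsSsbToTorusLRO) := by
  constructor
  · exact fun h _ => h
  · intro h
    by_cases hQ : WeakCouplingOrder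
    · exact h hQ
    · exact crux_of_not_weakCouplingOrder hQ

/-- The conjunct the route attacks and its complement, side by side: the summit follows from
`Q ∧ crux`, and `Q ∧ crux` is what the two cruxes of the route jointly supply. -/
theorem summit_of_weakCouplingOrder_and_crux (h : WeakCouplingOrder ∧ WcbcsSsbToTorusLRO) :
    _root_.HubbardSuperconductivity :=
  summit_of_crux_of_weakCouplingOrder h.2 h.1

/-! ## §C Child C (charging floor): grand-canonical exposure is midpoint convexity, verbatim -/

variable {Λ : Type*} [Fintype Λ] [LinearOrder Λ]

/-- LOCAL grand-canonical exposure of the filling `N + 2` among `{N, N+2, N+4}` at chemical potential `μ`: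
`E(N+2) − μ(N+2) ≤ E(M) − μM` for the two neighbouring even fillings. -/
def LocallyExposed (H : Matrix (Finset (Orb Λ)) (Finset (Orb Λ)) ℂ) (N : ℕ) (μ : ℝ) : Prop :=
  H.minEnergyOn (szSector (N + 2) 0) - μ * ((N + 2 : ℕ) : ℝ) ≤ H.minEnergyOn (szSector N 0) - μ * (N : ℝ) ∧
  H.minEnergyOn (szSector (N + 2) 0) - μ * ((N + 2 : ℕ) : ℝ) ≤
    H.minEnergyOn (szSector (N + 4) 0) - μ * ((N + 4 : ℕ) : ℝ)

/-- Exposure ⇒ the pair gap at `N + 2` is non-negative (the STRONG form of child C, with no `1/log L` room). -/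
theorem pairGap_nonneg_of_locallyExposed (H : Matrix (Finset (Orb Λ)) (Finset (Orb Λ)) ℂ) (N : ℕ) (μ : ℝ)
    (h : LocallyExposed H N μ) : 0 ≤ pairGap H (N + 2) := by
  obtain ⟨h1, h2⟩ := h
  unfold pairGap
  have e1 : (N + 2 - 2 : ℕ) = N := by omega
  have e2 : (N + 2 + 2 : ℕ) = N + 4 := by omega
  rw [e1, e2]
  push_cast at h1 h2 ⊢
  nlinarith

/-- … and conversely: a non-negative pair gap IS local exposure (at `μ̄ = (E(N+4) − E(N))/4`). So
"exposure of the pinned filling" is child C re-worded (a costume), not a supplier. -/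
theorem locallyExposed_of_pairGap_nonneg (H : Matrix (Finset (Orb Λ)) (Finset (Orb Λ)) ℂ) (N : ℕ)
    (h : 0 ≤ pairGap H (N + 2)) :
    LocallyExposed H N ((H.minEnergyOn (szSector (N + 4) 0) - H.minEnergyOn (szSector N 0)) / 4) := by
  unfold pairGap at h
  have e1 : (N + 2 - 2 : ℕ) = N := by omega
  have e2 : (N + 2 + 2 : ℕ) = N + 4 := by omega
  rw [e1, e2] at h
  unfold LocallyExposed
  push_cast
  constructor <;> nlinarith

/-! ## §D Certificate by dual witness: every-ground-state floors ARE operator PENALTY inequalities -/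

section Duality

variable {n : Type*} [Fintype n]

/-- EASY DIRECTION of finite-dimensional duality for the bottom face. If `A + λ (H − E₀) ≥ t` in quadratic
form on the unit vectors of a subspace `K` (`E₀` any level attained by the state at hand), then every
state of `K` at level `E₀` has `⟨A⟩ ≥ t`. -/
theorem floor_of_penalty (A H : Matrix n n ℂ) (K : Submodule ℂ (n → ℂ)) (E₀ t lam : ℝ)
    (hpen : ∀ φ ∈ K, star φ ⬝ᵥ φ = 1 →
      t ≤ (star φ ⬝ᵥ (A *ᵥ φ)).re + lam * ((star φ ⬝ᵥ (H *ᵥ φ)).re - E₀))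
    (ψ : n → ℂ) (hψK : ψ ∈ K) (hψ1 : star ψ ⬝ᵥ ψ = 1)
    (hmin : (star ψ ⬝ᵥ (H *ᵥ ψ)).re = E₀) :
    t ≤ (star ψ ⬝ᵥ (A *ᵥ ψ)).re := by
  have := hpen ψ hψK hψ1
  rw [hmin, sub_self, mul_zero, add_zero] at this
  exact this

/-- `re ⟨φ, φ⟩ = Σ_i ‖φ_i‖²`. -/
theorem re_star_dotProduct_self_eq_sum (φ : n → ℂ) : (star φ ⬝ᵥ φ).re = ∑ i, ‖φ i‖ ^ 2 := by
  simp [dotProduct, Complex.conj_mul', ← Complex.ofReal_pow]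

/-- Unit vectors (`⟨φ, φ⟩ = 1`) lie in the closed unit ball of the sup norm. -/
theorem norm_le_one_of_star_dotProduct_self_eq_one {φ : n → ℂ} (h : star φ ⬝ᵥ φ = 1) : ‖φ‖ ≤ 1 := by
  rw [pi_norm_le_iff_of_nonneg zero_le_one]
  intro i
  have h1 : ∑ j, ‖φ j‖ ^ 2 = 1 := by rw [← re_star_dotProduct_self_eq_sum, h]; simp
  have hi : ‖φ i‖ ^ 2 ≤ 1 := by
    rw [← h1]
    exact Finset.single_le_sum (f := fun j => ‖φ j‖ ^ 2) (fun j _ => sq_nonneg _) (Finset.mem_univ i)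
  nlinarith [norm_nonneg (φ i)]

/-- **CONVERSE (the dual witness exists): finite-dimensional duality for the bottom face, by compactness.**
If every unit vector of `K` at the bottom level `E₀` of `H` on `K` has `⟨A⟩ > t`, then for some `λ ≥ 0`
the PENALTY inequality `⟨A⟩ + λ (⟨H⟩ − E₀) ≥ t` holds for ALL unit vectors of `K`. Together with
`floor_of_penalty`: an every-ground-state floor on `A` IS the existence of such a `λ` — the "certificate by
dual witness" form of the crux's conclusion. (Qualitative: the size of `λ` is where the physics lives —
census r1 §Strengthen S-r1.2.) -/
theorem penalty_of_floor (A H : Matrix n n ℂ) (K : Submodule ℂ (n → ℂ)) (E₀ t : ℝ)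
    (hE₀ : ∀ φ ∈ K, star φ ⬝ᵥ φ = 1 → E₀ ≤ (star φ ⬝ᵥ (H *ᵥ φ)).re)
    (hfloor : ∀ ψ ∈ K, star ψ ⬝ᵥ ψ = 1 → (star ψ ⬝ᵥ (H *ᵥ ψ)).re = E₀ → t < (star ψ ⬝ᵥ (A *ᵥ ψ)).re) :
    ∃ lam : ℝ, 0 ≤ lam ∧ ∀ φ ∈ K, star φ ⬝ᵥ φ = 1 →
      t ≤ (star φ ⬝ᵥ (A *ᵥ φ)).re + lam * ((star φ ⬝ᵥ (H *ᵥ φ)).re - E₀) := by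
  classical
  by_contra hcon
  push Not at hcon
  -- quadratic forms are continuous
  have qA_cont : Continuous fun φ : n → ℂ => (star φ ⬝ᵥ (A *ᵥ φ)).re :=
    Complex.continuous_re.comp (continuous_star.dotProduct (continuous_const.matrix_mulVec continuous_id))
  have qH_cont : Continuous fun φ : n → ℂ => (star φ ⬝ᵥ (H *ᵥ φ)).re :=
    Complex.continuous_re.comp (continuous_star.dotProduct (continuous_const.matrix_mulVec continuous_id))
  have nrm_cont : Continuous fun φ : n → ℂ => star φ ⬝ᵥ φ := continuous_star.dotProduct continuous_id
  -- the unit sphere of `K` is compact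
  set S : Set (n → ℂ) := {φ | φ ∈ K ∧ star φ ⬝ᵥ φ = 1} with hSdef
  have hSclosed : IsClosed S :=
    (K.closed_of_finiteDimensional).inter (isClosed_eq nrm_cont continuous_const)
  have hSbdd : Bornology.IsBounded S := by
    refine (Metric.isBounded_closedBall (x := (0 : n → ℂ)) (r := 1)).subset ?_
    intro φ hφ
    rw [Metric.mem_closedBall, dist_zero_right]
    exact norm_le_one_of_star_dotProduct_self_eq_one hφ.2
  have hScompact : IsCompact S := Metric.isCompact_of_isClosed_isBounded hSclosed hSbdd
  -- a violating sequence, one vector per penalty `λ = k`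
  choose f hfK hf1 hflt using fun k : ℕ => hcon k (Nat.cast_nonneg k)
  obtain ⟨φs, hφsS, σ, hσ, hlim⟩ := hScompact.tendsto_subseq (x := f) (fun k => ⟨hfK k, hf1 k⟩)
  -- `⟨A⟩` is bounded below on `S`
  obtain ⟨B, hB⟩ : ∃ B : ℝ, ∀ φ ∈ S, B ≤ (star φ ⬝ᵥ (A *ᵥ φ)).re := by
    obtain ⟨B, hB⟩ := hScompact.bddBelow_image (f := fun φ : n → ℂ => (star φ ⬝ᵥ (A *ᵥ φ)).re)
      qA_cont.continuousOn
    exact ⟨B, fun φ hφ => hB ⟨φ, hφ, rfl⟩⟩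
  have hBt : B < t := by
    have h0 := hflt 0
    have hB0 := hB (f 0) ⟨hfK 0, hf1 0⟩
    simp only [Nat.cast_zero, zero_mul, add_zero] at h0
    linarith
  -- excess energies `e k ≥ 0` with `k * e k < t - B`
  set e : ℕ → ℝ := fun k => (star (f k) ⬝ᵥ (H *ᵥ f k)).re - E₀ with hedef
  have e_nonneg : ∀ k, 0 ≤ e k := fun k => sub_nonneg.2 (hE₀ _ (hfK k) (hf1 k))
  have ke_lt : ∀ k : ℕ, (k : ℝ) * e k < t - B := by
    intro k
    have h1 := hflt k
    have h2 := hB (f k) ⟨hfK k, hf1 k⟩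
    simp only [hedef]
    linarith
  -- along the subsequence `e (σ k) ≤ (t - B) / k → 0`
  have hσge : ∀ k, k ≤ σ k := fun k => hσ.id_le k
  have e_sub_le : ∀ k : ℕ, 0 < k → e (σ k) ≤ (t - B) / k := by
    intro k hk
    have hk' : (0 : ℝ) < k := by exact_mod_cast hk
    have hσk : (k : ℝ) ≤ σ k := by exact_mod_cast hσge k
    rw [le_div_iff₀ hk']
    have := ke_lt (σ k)
    have hek := e_nonneg (σ k)
    nlinarith
  have e_sub_tendsto : Tendsto (fun k => e (σ k)) atTop (nhds 0) := by
    have hup : Tendsto (fun k : ℕ => (t - B) / (k : ℝ)) atTop (nhds 0) :=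
      tendsto_const_div_atTop_nhds_zero_nat (t - B)
    refine tendsto_of_tendsto_of_tendsto_of_le_of_le' tendsto_const_nhds hup
      (Filter.Eventually.of_forall fun k => e_nonneg (σ k)) ?_
    filter_upwards [Filter.eventually_gt_atTop 0] with k hk using e_sub_le k hk
  -- continuity along the subsequence
  have hH_lim : Tendsto (fun k => e (σ k)) atTop (nhds ((star φs ⬝ᵥ (H *ᵥ φs)).re - E₀)) := by
    have := ((qH_cont.tendsto φs).comp hlim).sub_const E₀
    exact this
  have hE : (star φs ⬝ᵥ (H *ᵥ φs)).re = E₀ := by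
    have := tendsto_nhds_unique hH_lim e_sub_tendsto
    linarith
  have hA_lim : Tendsto (fun k => (star (f (σ k)) ⬝ᵥ (A *ᵥ f (σ k))).re) atTop
      (nhds ((star φs ⬝ᵥ (A *ᵥ φs)).re)) :=
    (qA_cont.tendsto φs).comp hlim
  have hA_le : (star φs ⬝ᵥ (A *ᵥ φs)).re ≤ t := by
    refine le_of_tendsto' hA_lim fun k => ?_
    have h1 := hflt (σ k)
    have h2 : 0 ≤ (σ k : ℝ) * e (σ k) := mul_nonneg (Nat.cast_nonneg _) (e_nonneg _)
    simp only [hedef] at h2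
    linarith
  exact absurd (hfloor φs hφsS.1 hφsS.2 hE) (not_lt.2 hA_le)

end Duality

end Summit.HubbardSuperconductivity.HubbardSuperconductivity.Cruxes.WcbcsSsbToTorusLRO.StrategistR1

end
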